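import Summits.MatrixMultiplication.OmegaCensus.STPPSmallPatternKernelSearch

/-!
# ω-census, `(2,1,1)^5` is infeasible in `ℤ/22` — kernel search, part 2 of 3

HONEST FRAMING (pub-omega census; verbatim): lottery ticket; floor = certified bounds/negative ranges.
Census STRUCTURE bookkeeping of the STPP track (seat pub-omega-stpp-3, gen 23; STRUCTURE row B5, the threshold column
`T1(H) = max {k : (2,1,1)^k ⊆ H}`, lower side), not progress on `ω`: small patterns in small groups bound no exponent.

Chunks of the kernel mask search `STPP211Neg.search (zcode 22) 5` (`decide +kernel`; ≈ 140 s of kernel time predicted at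
50 µs per mask translation of the Python mirror); assembled in `STPPSmallPatternNone211K5Z22.lean`.

References: H. Cohn, R. Kleinberg, B. Szegedy, C. Umans, FOCS 2005 (arXiv:math/0511460), Def. 5.1.  Record: pub-omega HOME
`pub-omega-stpp-3-g23/` (plans `py/cells/*.json` from the Python mirror `k211v3.py`; engine cross-checks: lister2/lister2b (gen 22),
gen211.c (gen 21), ENG1's lister211 — all COMPLETE NONE on these cells; not used by the proofs).
-/

set_option Elab.async false  -- several kernel pieces: elaborate sequentially (memory)

namespace Summit.MatrixMultiplication.OmegaCensus

namespace STPP211Neg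

/-- Chunk list 3 of `ℤ/22`, `k = 5` (entries `(d, x1)`: representative `d` of `A₀ = {0,d}`, first-level exclusion mask;
738697 mask translations in the mirror ≈ 37 s predicted). -/
def Z22k5.ch3 : List (ℕ × ℕ) := [(2, 127)]

/-- Kernel search over chunk list 3 of `ℤ/22`, `k = 5`. -/
theorem Z22k5.s3 : search (zcode 22) 5 Z22k5.ch3 = true := by
  decide +kernel

/-- Chunk list 4 of `ℤ/22`, `k = 5` (entries `(d, x1)`: representative `d` of `A₀ = {0,d}`, first-level exclusion mask;
1004625 mask translations in the mirror ≈ 50 s predicted). -/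
def Z22k5.ch4 : List (ℕ × ℕ) := [(11, 4194289)]

/-- Kernel search over chunk list 4 of `ℤ/22`, `k = 5`. -/
theorem Z22k5.s4 : search (zcode 22) 5 Z22k5.ch4 = true := by
  decide +kernel

/-- Chunk list 5 of `ℤ/22`, `k = 5` (entries `(d, x1)`: representative `d` of `A₀ = {0,d}`, first-level exclusion mask;
1053032 mask translations in the mirror ≈ 53 s predicted). -/
def Z22k5.ch5 : List (ℕ × ℕ) := [(11, 4193807)]

/-- Kernel search over chunk list 5 of `ℤ/22`, `k = 5`. -/
theorem Z22k5.s5 : search (zcode 22) 5 Z22k5.ch5 = true := by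
  decide +kernel

end STPP211Neg

end Summit.MatrixMultiplication.OmegaCensus
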